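import Summits.CriticalPhenomena.SAWScalingLimit.Theses.SAWTwistedSelfEnergy

/-!
# `DomainTransfer` — negative knowledge: the `n = 0` slice of the twisted kernel is free

Support file for the crux `stmt-CriticalPhenomena-17875`
(`Summit.CriticalPhenomena.SAWScalingLimit.Theses.SAWTwistedSelfEnergy.DomainTransfer :=
TwistedKernelSummable → TwistedKernelTailIndex → TwistedGapEquation → ObservableLimitFlat`, route
`SAWTwistedSelfEnergy`; refuter crux-attack, 2026-08-17).  The mathematics is the planner-registrar's
finding `Summits/CriticalPhenomena/SAWScalingLimit/Cruxes/TwistedGapEquation/Misstatement.lean`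
(planner-skel-stmt-CriticalPhenomena-17874-0, 2026-08-17), re-checked and landed here so that the two
refutations below are theorems of the tree (negative knowledge) and the crux's VACUITY is on record:

* the four kernel items of the route share one `let` block whose predicate `IsTwistedKernel K` mentions
  `K m` only for `m ∈ Finset.Icc 1 n` (recursion clause) and kills `K n z` only off `box 2 n` (support
  clause); since `box 2 0 = {0}`, the matrix `K 0 0` is UNCONSTRAINED (`isTwistedKernel_bump`; here the predicate is the set `twistedKernels`);
* `TwistedGapEquation` sums `n ∈ Finset.range (N + 1)`, so every partial sum contains the free term
  `∑ k, K 0 0 0 k * I ^ k`; bumping `K 0 0` by `E₀₀` shifts every partial sum by `1` (`partialSum_bump`),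
  hence `TwistedGapEquation ↔ ∀ K, K ∉ twistedKernels` (`twistedGapEquation_iff_no_kernel`);
* a twisted kernel EXISTS (`kstar`, `kstar_isTwistedKernel`: the `n ≥ 1` system is triangular because
  `G 0 = δ₀ • 1`, and off `box 2 n` every term of the recursion vanishes), so
  `twistedGapEquation_false : ¬ TwistedGapEquation` and, by the same free slice,
  `twistedKernelLowOrder_false : ¬ TwistedKernelLowOrder` (that item asks `K 0 z = 0`).

Consequence for the crux (NOT stated as a theorem here — a positive route-item proof is a prover's
landing and would be junk): `DomainTransfer` and `Assembly` take `TwistedGapEquation` as a HYPOTHESIS and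
are vacuously provable (`fun _ _ h => (twistedGapEquation_false h).elim`) until the planner restates the
kernel items.  REPAIR (class `misstated`; R1 of `Cruxes/TwistedGapEquation/MISSTATED.md`, restate strings
elaboration-checked there): prepend `K 0 = 0 ∧` to the `IsTwistedKernel` let of all four kernel items —
then the kernel is literally unique (`kstar_isTwistedKernel_repaired`) and `DomainTransfer` regains its
content unchanged; R2 (minimal): sum from `n = 1` in `TwistedGapEquation`, ask `1 ≤ n` in
`TwistedKernelLowOrder`.  `TwistedKernelSummable` / `TwistedKernelTailIndex` are insensitive to the free
slice (a finite perturbation of the summand family).  Everything proved, standard axioms. [folklore]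
-/

noncomputable section

open Filter Topology
open scoped BigOperators Topology Classical Matrix
open Literature.Probability.RandomPlanarGeometry Literature.Probability.LatticeModels

namespace Summit.CriticalPhenomena.SAWScalingLimit.Theorems.DomainTransfer.Negative

/-! ### Vocabulary: the route's shared `let` block, letter for letter -/

/-- The four lattice directions `E, N, W, S` (the route's `let dir`). [folklore] -/
def dir : Fin 4 → Site 2 := ![![1, 0], ![0, 1], ![-1, 0], ![0, -1]]

/-- The spin `σ = 5/8` (the route's `let σ`). [folklore] -/
def spin : ℝ := 5 / 8

/-- The one-step twisted non-backtracking matrix `T` (the route's `let T`). [folklore] -/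
def stepMatrix : Matrix (Fin 4) (Fin 4) ℂ := fun a b =>
  if dir b = -dir a then 0 else
    Complex.exp (-Complex.I * spin *
      (turning (-Site.toComplex (dir a)) 0 (Site.toComplex (dir b)) : ℝ))

/-- The twisted two-point matrices `G n z` of the `ℤ²` self-avoiding walk (the route's `let G`). [folklore] -/
def twoPoint : ℕ → Site 2 → Matrix (Fin 4) (Fin 4) ℂ := fun n z ι κ =>
  if n = 0 then (if z = 0 ∧ ι = κ then 1 else 0) else
    ∑ p ∈ ((zdGraph 2).finsetWalkLength n (0 : Site 2) z).filter (fun p => p.IsPath),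
      (if p.getVert 1 = -dir ι ∨ z - p.getVert (n - 1) ≠ dir κ then 0 else
        Complex.exp (-Complex.I * spin *
          (winding ((-Site.toComplex (dir ι)) :: (p.support.map Site.toComplex)) : ℝ)))

/-- The route's `let IsTwistedKernel`, as the SET of kernels satisfying it: support in `box 2 n` and
the square resolvent recursion for `n ≥ 1`.  NOTE: `K 0` occurs nowhere in the recursion clause. [folklore] -/
def twistedKernels : Set (ℕ → Site 2 → Matrix (Fin 4) (Fin 4) ℂ) :=
  {K | (∀ n z, z ∉ box 2 n → K n z = 0) ∧
    (∀ n, 1 ≤ n → ∀ z, twoPoint n z =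
      Matrix.of (fun ι κ => ∑ κ' : Fin 4, twoPoint (n - 1) (z - dir κ) ι κ' * stepMatrix κ' κ) +
        ∑ m ∈ Finset.Icc 1 n, ∑ y ∈ box 2 m, K m y * twoPoint (n - m) (z - y))}

/-- The spin-sector partial sums of `TwistedGapEquation` (they start at `n = 0`). [folklore] -/
def partialSum (K : ℕ → Site 2 → Matrix (Fin 4) (Fin 4) ℂ) (N : ℕ) : ℂ :=
  ∑ n ∈ Finset.range (N + 1), (SAW.criticalFugacity : ℂ) ^ n *
    ∑ z ∈ box 2 n, ∑ k : Fin 4, K n z 0 k * Complex.I ^ (k : ℕ)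

/-- The gap-equation value `1 - x_c (1 + 2 cos (3π/16))`. [folklore] -/
def gapValue : ℂ :=
  1 - (SAW.criticalFugacity : ℂ) * ((1 + 2 * Real.cos (3 * Real.pi / 16) : ℝ) : ℂ)

/-- Sanity (definitional): the route's `TwistedGapEquation` is the statement over this vocabulary. [folklore] -/
theorem twistedGapEquation_iff :
    Summit.CriticalPhenomena.SAWScalingLimit.Theses.SAWTwistedSelfEnergy.TwistedGapEquation ↔
      ∀ K, K ∈ twistedKernels → Tendsto (partialSum K) atTop (𝓝 gapValue) :=
  Iff.rfl

/-- Sanity (definitional): the route's support item `TwistedKernelLowOrder` over this vocabulary. [folklore] -/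
theorem twistedKernelLowOrder_iff :
    Summit.CriticalPhenomena.SAWScalingLimit.Theses.SAWTwistedSelfEnergy.TwistedKernelLowOrder ↔
      ∀ K, K ∈ twistedKernels → (∀ n, n ≤ 3 → ∀ z, K n z = 0) ∧ (∀ z, z ≠ 0 → K 4 z = 0) ∧
        Matrix.trace (K 4 0) = ((4 * Real.sqrt 2 : ℝ) : ℂ) :=
  Iff.rfl

/-! ### The free `n = 0` slice -/

/-- The matrix unit `E₀₀`. [folklore] -/
def unit00 : Matrix (Fin 4) (Fin 4) ℂ := Matrix.of fun i j => if i = 0 ∧ j = 0 then 1 else 0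

/-- Bump a kernel at `(n, z) = (0, 0)` by `E₀₀`. [folklore] -/
def bump (K : ℕ → Site 2 → Matrix (Fin 4) (Fin 4) ℂ) : ℕ → Site 2 → Matrix (Fin 4) (Fin 4) ℂ :=
  fun n z => if n = 0 ∧ z = 0 then K n z + unit00 else K n z

/-- Bumping preserves `IsTwistedKernel`: the recursion clause only sees `K m`, `m ≥ 1`, and the support
clause only sees `K 0 z` for `z ≠ 0`. [folklore] -/
theorem isTwistedKernel_bump {K : ℕ → Site 2 → Matrix (Fin 4) (Fin 4) ℂ}
    (hK : K ∈ twistedKernels) : bump K ∈ twistedKernels := by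
  refine ⟨fun n z hz => ?_, fun n hn z => ?_⟩
  · unfold bump
    split_ifs with h0
    · exact absurd (h0.2 ▸ zero_mem_box 2 n) hz
    · exact hK.1 n z hz
  · rw [hK.2 n hn z]
    congr 1
    refine Finset.sum_congr rfl fun m hm => Finset.sum_congr rfl fun y _ => ?_
    have hm1 : m ≠ 0 := by
      have := (Finset.mem_Icc.1 hm).1
      omega
    simp [bump, hm1]

/-- Bumping shifts every partial sum of `TwistedGapEquation` by exactly `1`. [folklore] -/
theorem partialSum_bump (K : ℕ → Site 2 → Matrix (Fin 4) (Fin 4) ℂ) (N : ℕ) :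
    partialSum (bump K) N = partialSum K N + 1 := by
  unfold partialSum
  rw [Finset.sum_range_succ' _ N, Finset.sum_range_succ' (fun n => (SAW.criticalFugacity : ℂ) ^ n *
    ∑ z ∈ box 2 n, ∑ k : Fin 4, K n z 0 k * Complex.I ^ (k : ℕ)) N]
  have h1 : ∀ i z, bump K (i + 1) z = K (i + 1) z := fun i z => by simp [bump]
  simp only [h1, SAW.box_two_zero, Finset.sum_singleton, pow_zero, one_mul]
  have h0 : bump K 0 0 = K 0 0 + unit00 := by simp [bump]
  rw [h0]
  simp [Fin.sum_univ_four, unit00, Matrix.add_apply]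
  ring

/-- **The defect.** If ANY twisted kernel exists, `TwistedGapEquation` as typed is false. [folklore] -/
theorem not_twistedGapEquation_of_kernel (K : ℕ → Site 2 → Matrix (Fin 4) (Fin 4) ℂ)
    (hK : K ∈ twistedKernels) :
    ¬ Summit.CriticalPhenomena.SAWScalingLimit.Theses.SAWTwistedSelfEnergy.TwistedGapEquation := by
  intro h
  rw [twistedGapEquation_iff] at h
  have h1 : Tendsto (fun N => partialSum K N + 1) atTop (𝓝 (gapValue + 1)) := (h K hK).add_const 1
  have h2 : Tendsto (fun N => partialSum K N + 1) atTop (𝓝 gapValue) :=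
    (h (bump K) (isTwistedKernel_bump hK)).congr (partialSum_bump K)
  have := tendsto_nhds_unique h2 h1
  have : (1 : ℂ) = 0 := by linear_combination -this
  exact one_ne_zero this

/-- Equivalently: `TwistedGapEquation` as typed says "no twisted kernel exists". [folklore] -/
theorem twistedGapEquation_iff_no_kernel :
    Summit.CriticalPhenomena.SAWScalingLimit.Theses.SAWTwistedSelfEnergy.TwistedGapEquation ↔
      ∀ K, K ∉ twistedKernels :=
  ⟨fun h K hK => not_twistedGapEquation_of_kernel K hK h,
    fun h => (twistedGapEquation_iff).2 fun K hK => absurd hK (h K)⟩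

/-- The same free slice sinks the support item `TwistedKernelLowOrder` (it asks `K 0 z = 0`). [folklore] -/
theorem not_twistedKernelLowOrder_of_kernel (K : ℕ → Site 2 → Matrix (Fin 4) (Fin 4) ℂ)
    (hK : K ∈ twistedKernels) :
    ¬ Summit.CriticalPhenomena.SAWScalingLimit.Theses.SAWTwistedSelfEnergy.TwistedKernelLowOrder := by
  intro h
  rw [twistedKernelLowOrder_iff] at h
  have h1 : K 0 0 = 0 := (h K hK).1 0 (by norm_num) 0
  have h2 : bump K 0 0 = 0 := (h (bump K) (isTwistedKernel_bump hK)).1 0 (by norm_num) 0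
  have h3 : bump K 0 0 = K 0 0 + unit00 := by simp [bump]
  rw [h3, h1, zero_add] at h2
  have : unit00 0 0 = 0 := by rw [h2]; rfl
  simp [unit00] at this

/-! ### A twisted kernel EXISTS (the `n ≥ 1` system is triangular) -/

/-- The `T`-term of the recursion at level `n` (the `Matrix.of …` summand of `IsTwistedKernel`). [folklore] -/
def tTerm (n : ℕ) (z : Site 2) : Matrix (Fin 4) (Fin 4) ℂ :=
  Matrix.of fun ι κ => ∑ κ' : Fin 4, twoPoint (n - 1) (z - dir κ) ι κ' * stepMatrix κ' κ

/-- Approximants of the canonical kernel: `kApprox N m` is the kernel at the levels `m ≤ N` (and `0`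
above), built level by level by solving the triangular recursion. [folklore] -/
def kApprox : ℕ → ℕ → Site 2 → Matrix (Fin 4) (Fin 4) ℂ
  | 0 => fun _ _ => 0
  | N + 1 => fun m z =>
      if m ≤ N then kApprox N m z
      else if m = N + 1 then
        (if z ∈ box 2 (N + 1) then
          twoPoint (N + 1) z - tTerm (N + 1) z -
            ∑ j ∈ Finset.Icc 1 N, ∑ y ∈ box 2 j, kApprox N j y * twoPoint (N + 1 - j) (z - y)
        else 0)
      else 0

/-- **The canonical twisted kernel** `K⋆`: `K⋆ 0 = 0`, and for `n ≥ 1`, `z ∈ box 2 n`,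
`K⋆ n z = G n z − (T-term) − Σ_{1 ≤ m < n} Σ_y K⋆ m y · G (n−m) (z−y)` (the `m = n` term of the
recursion isolates `K n z` because `G 0 = δ₀ • 1`). [folklore] -/
def kstar (n : ℕ) : Site 2 → Matrix (Fin 4) (Fin 4) ℂ := kApprox n n

/-- The approximants stabilise: `kApprox N m = K⋆ m` for `m ≤ N`. [folklore] -/
theorem kApprox_of_le {N m : ℕ} (h : m ≤ N) : kApprox N m = kstar m := by
  induction N with
  | zero =>
    obtain rfl : m = 0 := Nat.le_zero.1 h
    rfl
  | succ N ih =>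
    rcases Nat.lt_or_eq_of_le h with h' | rfl
    · have hle : m ≤ N := Nat.lt_succ_iff.1 h'
      funext z
      rw [← ih hle]
      simp only [kApprox, if_pos hle]
    · rfl

/-- `K⋆ 0 = 0`. [folklore] -/
theorem kstar_zero : kstar 0 = 0 := rfl

/-- The defining recursion of `K⋆` at level `N + 1`. [folklore] -/
theorem kstar_succ (N : ℕ) (z : Site 2) :
    kstar (N + 1) z = if z ∈ box 2 (N + 1) then twoPoint (N + 1) z - tTerm (N + 1) z -
      ∑ j ∈ Finset.Icc 1 N, ∑ y ∈ box 2 j, kstar j y * twoPoint (N + 1 - j) (z - y) else 0 := by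
  have h1 : ¬ (N + 1 ≤ N) := Nat.not_succ_le_self N
  show kApprox (N + 1) (N + 1) z = _
  simp only [kApprox, if_neg h1, if_true]
  split_ifs with hz
  · congr 1
    refine Finset.sum_congr rfl fun j hj => Finset.sum_congr rfl fun y _ => ?_
    rw [kApprox_of_le (Finset.mem_Icc.1 hj).2]
  · rfl

/-- `K⋆ n` is supported in `box 2 n`. [folklore] -/
theorem kstar_eq_zero_of_not_mem {n : ℕ} {z : Site 2} (hz : z ∉ box 2 n) : kstar n z = 0 := by
  cases n with
  | zero => rfl
  | succ N => rw [kstar_succ, if_neg hz]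

/-- `G 0 w = δ₀(w) • 1`, entrywise. [folklore] -/
theorem twoPoint_zero_apply (w : Site 2) (ι κ : Fin 4) :
    twoPoint 0 w ι κ = if w = 0 ∧ ι = κ then 1 else 0 := by
  dsimp only [twoPoint]
  rw [if_pos rfl]

/-- Convolution with `G 0` is evaluation: the `m = n` term of the recursion isolates `K n z`. [folklore] -/
theorem sum_mul_twoPoint_zero (f : Site 2 → Matrix (Fin 4) (Fin 4) ℂ) (s : Finset (Site 2))
    (z : Site 2) : ∑ y ∈ s, f y * twoPoint 0 (z - y) = if z ∈ s then f z else 0 := by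
  have h : ∀ y, twoPoint 0 (z - y) = if z = y then 1 else 0 := by
    intro y
    ext ι κ
    rw [twoPoint_zero_apply]
    by_cases hzy : z = y
    · subst hzy
      simp [Matrix.one_apply]
    · have hne : z - y ≠ 0 := sub_ne_zero.2 hzy
      simp [hne, hzy]
  simp_rw [h, mul_ite, mul_one, mul_zero]
  exact Finset.sum_ite_eq s z f

/-- An `n`-step lattice walk from `0` ends in `box 2 n`. [folklore] -/
theorem mem_box_of_walk {z : Site 2} (p : (zdGraph 2).Walk (0 : Site 2) z) : z ∈ box 2 p.length := by
  have h : ∀ j, |p.getVert p.length j| ≤ ((p.length : ℕ) : ℤ) :=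
    SAW.Zd.abs_apply_le_of_adj (d := 2) (ω := fun i => p.getVert i) (n := p.length)
      p.getVert_zero (fun i hi => p.adj_getVert_succ hi) p.length le_rfl
  rw [p.getVert_length] at h
  rw [mem_box]
  intro i
  exact abs_le.1 (h i)

/-- `G n` is supported in `box 2 n`. [folklore] -/
theorem twoPoint_eq_zero_of_not_mem {n : ℕ} {z : Site 2} (hz : z ∉ box 2 n) : twoPoint n z = 0 := by
  cases n with
  | zero =>
    ext ι κ
    rw [twoPoint_zero_apply, Matrix.zero_apply, if_neg]
    rintro ⟨rfl, -⟩
    exact hz (zero_mem_box 2 0)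
  | succ N =>
    ext ι κ
    dsimp only [twoPoint]
    rw [if_neg (Nat.succ_ne_zero N), Matrix.zero_apply]
    apply Finset.sum_eq_zero
    intro p hp
    exfalso
    have hlen : p.length = N + 1 := SimpleGraph.mem_finsetWalkLength_iff.1 (Finset.mem_filter.1 hp).1
    exact hz (hlen ▸ mem_box_of_walk p)

/-- The unit directions lie in `box 2 1`. [folklore] -/
theorem dir_mem_box_one (κ : Fin 4) : dir κ ∈ box 2 1 := by
  fin_cases κ <;> simp [dir, mem_box, Fin.forall_fin_two]

/-- Boxes add: `box 2 m + box 2 k ⊆ box 2 (m + k)`. [folklore] -/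
theorem add_mem_box {m k : ℕ} {a b : Site 2} (ha : a ∈ box 2 m) (hb : b ∈ box 2 k) :
    a + b ∈ box 2 (m + k) := by
  rw [mem_box] at ha hb ⊢
  intro i
  obtain ⟨h1, h2⟩ := ha i
  obtain ⟨h3, h4⟩ := hb i
  simp only [Pi.add_apply, Nat.cast_add]
  constructor <;> linarith

/-- The `T`-term is supported in `box 2 n` as well. [folklore] -/
theorem tTerm_eq_zero_of_not_mem {N : ℕ} {z : Site 2} (hz : z ∉ box 2 (N + 1)) :
    tTerm (N + 1) z = 0 := by
  ext ι κ
  simp only [tTerm, Matrix.of_apply, Matrix.zero_apply, Nat.add_sub_cancel]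
  apply Finset.sum_eq_zero
  intro κ' _
  have h : z - dir κ ∉ box 2 N := fun h => hz (by simpa using add_mem_box h (dir_mem_box_one κ))
  rw [twoPoint_eq_zero_of_not_mem h, Matrix.zero_apply, zero_mul]

/-- **`K⋆` is a twisted kernel in the sense of the route** (support clause + the square recursion for
all `n ≥ 1` and ALL `z`, on and off the box). [folklore] -/
theorem kstar_isTwistedKernel : kstar ∈ twistedKernels := by
  refine ⟨fun n z hz => kstar_eq_zero_of_not_mem hz, fun n hn z => ?_⟩
  obtain ⟨N, rfl⟩ : ∃ N, n = N + 1 := ⟨n - 1, by omega⟩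
  have ht : (Matrix.of fun ι κ => ∑ κ' : Fin 4,
      twoPoint (N + 1 - 1) (z - dir κ) ι κ' * stepMatrix κ' κ) = tTerm (N + 1) z := rfl
  rw [ht, Finset.sum_Icc_succ_top (by omega : 1 ≤ N + 1), Nat.sub_self, sum_mul_twoPoint_zero]
  by_cases hz : z ∈ box 2 (N + 1)
  · rw [if_pos hz, kstar_succ, if_pos hz]
    abel
  · rw [if_neg hz, twoPoint_eq_zero_of_not_mem hz, add_zero, tTerm_eq_zero_of_not_mem hz, zero_add]
    symm
    apply Finset.sum_eq_zero
    intro j hj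
    apply Finset.sum_eq_zero
    intro y hy
    have hj' := Finset.mem_Icc.1 hj
    have h : z - y ∉ box 2 (N + 1 - j) := fun h => hz (by
      have h2 := add_mem_box hy h
      have e : j + (N + 1 - j) = N + 1 := by omega
      rwa [add_sub_cancel, e] at h2)
    rw [twoPoint_eq_zero_of_not_mem h, mul_zero]

/-- `K⋆` also has the vanishing `n = 0` slice, i.e. it satisfies the REPAIRED predicate (R1: prepend
`K 0 = 0 ∧`) too — after the repair the kernel items are statements about `K⋆` alone. [folklore] -/
theorem kstar_isTwistedKernel_repaired : kstar 0 = 0 ∧ kstar ∈ twistedKernels :=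
  ⟨kstar_zero, kstar_isTwistedKernel⟩

/-- Uniqueness under the REPAIRED predicate (R1): any two kernels with `K 0 = 0 ∧ IsTwistedKernel K`
agree (levels `n ≥ 1` are forced by the triangular recursion, level `0` by the new clause), so after the
repair every kernel item is a statement about `K⋆` alone. [folklore] -/
theorem isTwistedKernel_repaired_unique {K K' : ℕ → Site 2 → Matrix (Fin 4) (Fin 4) ℂ}
    (hK : K 0 = 0 ∧ K ∈ twistedKernels) (hK' : K' 0 = 0 ∧ K' ∈ twistedKernels) : K = K' := by
  funext n
  induction n using Nat.strong_induction_on with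
  | _ n ih =>
    cases n with
    | zero => rw [hK.1, hK'.1]
    | succ N =>
      funext z
      by_cases hz : z ∈ box 2 (N + 1)
      · have e := (hK.2.2 (N + 1) (by omega) z).symm.trans (hK'.2.2 (N + 1) (by omega) z)
        rw [Finset.sum_Icc_succ_top (by omega : 1 ≤ N + 1), Finset.sum_Icc_succ_top (by omega : 1 ≤ N + 1),
          Nat.sub_self, sum_mul_twoPoint_zero, sum_mul_twoPoint_zero, if_pos hz, if_pos hz] at e
        have hs : ∑ m ∈ Finset.Icc 1 N, ∑ y ∈ box 2 m, K m y * twoPoint (N + 1 - m) (z - y) =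
            ∑ m ∈ Finset.Icc 1 N, ∑ y ∈ box 2 m, K' m y * twoPoint (N + 1 - m) (z - y) := by
          refine Finset.sum_congr rfl fun m hm => Finset.sum_congr rfl fun y _ => ?_
          rw [ih m (by have := (Finset.mem_Icc.1 hm).2; omega)]
        rw [hs] at e
        exact add_left_cancel (add_left_cancel e)
      · rw [hK.2.1 _ _ hz, hK'.2.1 _ _ hz]

/-! ### The two refutations -/

/-- **REFUTATION of `SAWTwistedSelfEnergy.TwistedGapEquation` as typed** (item stmt-CriticalPhenomena-17874;
class `misstated`: the free `n = 0` slice; repaired statement: prepend `K 0 = 0 ∧` to the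
`IsTwistedKernel` let, or sum from `n = 1` — the witness misses both repairs). [folklore] -/
theorem twistedGapEquation_false :
    ¬ Summit.CriticalPhenomena.SAWScalingLimit.Theses.SAWTwistedSelfEnergy.TwistedGapEquation :=
  not_twistedGapEquation_of_kernel kstar kstar_isTwistedKernel

/-- **REFUTATION of the support item `SAWTwistedSelfEnergy.TwistedKernelLowOrder` as typed** (item
stmt-CriticalPhenomena-17876; same class, same repair; the witness misses the repair). [folklore] -/
theorem twistedKernelLowOrder_false :
    ¬ Summit.CriticalPhenomena.SAWScalingLimit.Theses.SAWTwistedSelfEnergy.TwistedKernelLowOrder :=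
  not_twistedKernelLowOrder_of_kernel kstar kstar_isTwistedKernel

end Summit.CriticalPhenomena.SAWScalingLimit.Theorems.DomainTransfer.Negative

end
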